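import Summits.Ventures.HodgeRepro2.T5RecordSatakeFourPrime
import Summits.Ventures.HodgeRepro2.T5CyclotomicFourSplitPrime
import Mathlib.NumberTheory.LSeries.PrimesInAP

/-!
# Infinitely many inert and infinitely many split places of the toy field `ℚ(i)`, by Dirichlet

Tier-5 support N3 / §G-N4.2 (seat p3, gen 78). File 261 for the toy field: Dirichlet's theorem (Mathlib's
`Nat.infinite_setOf_prime_and_eq_mod`) gives infinitely many primes `p ≡ 3 (mod 4)` and `p ≡ 1 (mod 4)`, so the
inert family of files 259–260 and the split family of file 262 are infinite sets of places of `ℚ(i)⁺ = ℚ`: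

* `infinite_setOf_prime_and_orderOf_eq_two`, `infinite_setOf_prime_and_orderOf_eq_one`;
* `vPrimeOf_injective`, `vSplitOf_injective` — the places `(p)` are pairwise distinct (`N(v) = p`);
* **`infinite_setOf_staysPrime`** — infinitely many places of `ℚ(i)⁺` stay prime in `ℚ(i)`;
* **`infinite_setOf_nonempty_algEquiv_polynomial`** — at infinitely many places `v` the record's spherical Hecke
  algebra `H(U(1 ⊗ H₀), K_v)` is `k[X]`;
* **`infinite_setOf_ncard_primesOver_eq_two`**, **`infinite_setOf_heckeAlgebra_mul_comm`** — infinitely many places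
  have two places of `ℚ(i)` above them, and there the record's spherical Hecke algebra is commutative.

§8(d): uses an L-value-free non-vanishing device: NO.
-/

open NumberField NumberField.IsCMField IsDedekindDomain IsDedekindDomain.HeightOneSpectrum Module Polynomial
open scoped TensorProduct Pointwise
open Summit.Ventures.HodgeRepro2.T5UnitaryGroupForm Summit.Ventures.HodgeRepro2.T5UnitaryHeckeAdjoint
  Summit.Ventures.HodgeRepro2.T5HeckePermutationModule Summit.Ventures.HodgeRepro2.T5RecordHyperspecial
  Summit.Ventures.HodgeRepro2.T5RecordSatakeToy Summit.Ventures.HodgeRepro2.T5SplitPlaceUnitaryGroup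
  Summit.Ventures.HodgeRepro2.T5CyclotomicFourInertPrime Summit.Ventures.HodgeRepro2.T5RecordSatakeFourPrime
  Summit.Ventures.HodgeRepro2.T5CyclotomicFourSplitPrime Summit.Ventures.HodgeRepro2.T5RecordSatakeInertToy
  Summit.Ventures.HodgeRepro2.T5CMCensusToy Summit.Ventures.HodgeRepro2.T5RecordSatakeInertToyDegree
  Summit.Ventures.HodgeRepro2.T5FinitePlaceCM Summit.Ventures.HodgeRepro2.T5StarOfInvolution
  Summit.Ventures.HodgeRepro2.T5NonSplitPlaceUnitaryGroup Summit.Ventures.HodgeRepro2.T5GlobalLatticeAlmostAll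
  Summit.Ventures.HodgeRepro2.T5FinitePlaceSplitClassification

namespace Summit.Ventures.HodgeRepro2.T5CyclotomicFourInfinitelyMany

section Dirichlet

/-- **Infinitely many primes `p ≡ 3 (mod 4)`**, i.e. of order `2` modulo `4` (Dirichlet for the unit class `3`). -/
theorem infinite_setOf_prime_and_orderOf_eq_two :
    {p : ℕ | p.Prime ∧ orderOf (p : ZMod (2 ^ 2)) = 2}.Infinite := by
  have hu : IsUnit ((3 : ℕ) : ZMod (2 ^ 2)) := ⟨ZMod.unitOfCoprime 3 (by norm_num), rfl⟩
  refine (Nat.infinite_setOf_prime_and_eq_mod hu).mono ?_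
  intro p hp
  refine ⟨hp.1, ?_⟩
  rw [hp.2]
  exact T5CyclotomicFourInertPrime.orderOf_natCast_three_zmod_four

/-- **Infinitely many primes `p ≡ 1 (mod 4)`**, i.e. of order `1` modulo `4` (Dirichlet for the unit class `1`). -/
theorem infinite_setOf_prime_and_orderOf_eq_one :
    {p : ℕ | p.Prime ∧ orderOf (p : ZMod (2 ^ 2)) = 1}.Infinite := by
  have hu : IsUnit ((1 : ℕ) : ZMod (2 ^ 2)) := ⟨ZMod.unitOfCoprime 1 (by norm_num), rfl⟩
  refine (Nat.infinite_setOf_prime_and_eq_mod hu).mono ?_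
  intro p hp
  refine ⟨hp.1, ?_⟩
  rw [hp.2, Nat.cast_one, orderOf_one]

end Dirichlet

section Four

variable (K : Type*) [Field K] [CharZero K] [IsCyclotomicExtension {2 ^ 2} ℚ K]

/-- The inert places `(p)`, indexed by the primes `p ≡ 3 (mod 4)`. -/
noncomputable def vPrimeOf (p : {p : ℕ // p.Prime ∧ orderOf (p : ZMod (2 ^ 2)) = 2}) :
    HeightOneSpectrum (𝓞 (maximalRealSubfield K)) :=
  vPrime K p.1 (hp := ⟨p.2.1⟩) p.2.2

/-- The split places `(p)`, indexed by the primes `p ≡ 1 (mod 4)`. -/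
noncomputable def vSplitOf (p : {p : ℕ // p.Prime ∧ orderOf (p : ZMod (2 ^ 2)) = 1}) :
    HeightOneSpectrum (𝓞 (maximalRealSubfield K)) :=
  vSplit K p.1 (hp := ⟨p.2.1⟩) p.2.2

/-- Distinct primes give distinct inert places (`N(vPrime p) = p`). -/
theorem vPrimeOf_injective :
    haveI := numberField K; haveI := isCMField_four K
    Function.Injective (vPrimeOf K) := by
  haveI := numberField K
  haveI := isCMField_four K
  intro p q h
  have hp := absNorm_vPrime K p.1 (hp := ⟨p.2.1⟩) p.2.2
  have hq := absNorm_vPrime K q.1 (hp := ⟨q.2.1⟩) q.2.2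
  have h' : (vPrimeOf K p).asIdeal = (vPrimeOf K q).asIdeal := by rw [h]
  have h3 : p.1 = q.1 := by
    rw [← hp, ← hq]
    exact h'.symm ▸ rfl
  exact Subtype.ext h3

/-- Distinct primes give distinct split places (`N(vSplit p) = p`). -/
theorem vSplitOf_injective :
    haveI := numberField K; haveI := isCMField_four K
    Function.Injective (vSplitOf K) := by
  haveI := numberField K
  haveI := isCMField_four K
  intro p q h
  have hp := absNorm_vSplit K p.1 (hp := ⟨p.2.1⟩) p.2.2
  have hq := absNorm_vSplit K q.1 (hp := ⟨q.2.1⟩) q.2.2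
  have h' : (vSplitOf K p).asIdeal = (vSplitOf K q).asIdeal := by rw [h]
  have h3 : p.1 = q.1 := by
    rw [← hp, ← hq]
    exact h'.symm ▸ rfl
  exact Subtype.ext h3

/-- **Infinitely many places of `ℚ(i)⁺` stay prime in `ℚ(i)`** (`v 𝓞_K = w` for some place `w`). -/
theorem infinite_setOf_staysPrime :
    haveI := numberField K; haveI := isCMField_four K
    {v : HeightOneSpectrum (𝓞 (maximalRealSubfield K)) | ∃ w : HeightOneSpectrum (𝓞 K),
      Ideal.map (algebraMap (𝓞 (maximalRealSubfield K)) (𝓞 K)) v.asIdeal = w.asIdeal}.Infinite := by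
  haveI := numberField K
  haveI := isCMField_four K
  haveI : Infinite {p : ℕ // p.Prime ∧ orderOf (p : ZMod (2 ^ 2)) = 2} :=
    infinite_setOf_prime_and_orderOf_eq_two.to_subtype
  exact Set.infinite_of_injective_forall_mem (vPrimeOf_injective K) fun p =>
    ⟨wPrime K p.1 (hp := ⟨p.2.1⟩) p.2.2, map_vPrime K p.1 (hp := ⟨p.2.1⟩) p.2.2⟩

/-- **At infinitely many places `v` of `ℚ(i)⁺` the record's spherical Hecke algebra `H(U(1 ⊗ H₀), K_v)` is `k[X]`**,
for every family `l` of generators of `𝓞_{ℚ(i)}` over `𝓞_{ℚ(i)⁺}`. -/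
theorem infinite_setOf_nonempty_algEquiv_polynomial (k : Type*) [Field k] :
    haveI := numberField K; haveI := isCMField_four K
    {v : HeightOneSpectrum (𝓞 (maximalRealSubfield K)) | ∀ {r : ℕ} (l : Fin r → 𝓞 K),
      Submodule.span (𝓞 (maximalRealSubfield K)) (Set.range l) = ⊤ →
      Nonempty (Polynomial k ≃ₐ[k]
        (letI := tensorStarRing K v; ↥(heckeAlgebra k (recordHyperspecial K v l (gramToy K)))))}.Infinite := by
  haveI := numberField K
  haveI := isCMField_four K
  haveI : Infinite {p : ℕ // p.Prime ∧ orderOf (p : ZMod (2 ^ 2)) = 2} :=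
    infinite_setOf_prime_and_orderOf_eq_two.to_subtype
  exact Set.infinite_of_injective_forall_mem (vPrimeOf_injective K) fun p {r} l hl =>
    nonempty_algEquiv_polynomial_record_four_prime K p.1 (hp := ⟨p.2.1⟩) p.2.2 k l hl

/-- **Infinitely many places of `ℚ(i)⁺` have exactly two places of `ℚ(i)` above them.** -/
theorem infinite_setOf_ncard_primesOver_eq_two :
    haveI := numberField K; haveI := isCMField_four K
    {v : HeightOneSpectrum (𝓞 (maximalRealSubfield K)) | (v.asIdeal.primesOver (𝓞 K)).ncard = 2}.Infinite := by
  haveI := numberField K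
  haveI := isCMField_four K
  haveI : Infinite {p : ℕ // p.Prime ∧ orderOf (p : ZMod (2 ^ 2)) = 1} :=
    infinite_setOf_prime_and_orderOf_eq_one.to_subtype
  exact Set.infinite_of_injective_forall_mem (vSplitOf_injective K) fun p =>
    ncard_primesOver_vSplit K p.1 (hp := ⟨p.2.1⟩) p.2.2

/-- **At infinitely many places `v` of `ℚ(i)⁺` with two places above them, the record's spherical Hecke algebra
`H(U(1 ⊗ H₀), K_v)` is commutative**, for every family `l` of generators. -/
theorem infinite_setOf_heckeAlgebra_mul_comm (k : Type*) [Field k] :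
    haveI := numberField K; haveI := isCMField_four K
    {v : HeightOneSpectrum (𝓞 (maximalRealSubfield K)) | (v.asIdeal.primesOver (𝓞 K)).ncard = 2 ∧
      ∀ {r : ℕ} (l : Fin r → 𝓞 K), Submodule.span (𝓞 (maximalRealSubfield K)) (Set.range l) = ⊤ →
      ∀ T S : (letI := tensorStarRing K v; ↥(heckeAlgebra k (recordHyperspecial K v l (gramToy K)))),
        T * S = S * T}.Infinite := by
  haveI := numberField K
  haveI := isCMField_four K
  haveI : Infinite {p : ℕ // p.Prime ∧ orderOf (p : ZMod (2 ^ 2)) = 1} :=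
    infinite_setOf_prime_and_orderOf_eq_one.to_subtype
  exact Set.infinite_of_injective_forall_mem (vSplitOf_injective K) fun p =>
    ⟨ncard_primesOver_vSplit K p.1 (hp := ⟨p.2.1⟩) p.2.2, fun {r} l hl T S =>
      heckeAlgebra_mul_comm_record_four_split K p.1 (hp := ⟨p.2.1⟩) p.2.2 k l hl T S⟩

end Four

end Summit.Ventures.HodgeRepro2.T5CyclotomicFourInfinitelyMany
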